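import Mathlib
import Summits.Ventures.PercRepro2.SwOutAll
import Summits.Ventures.PercRepro2.SwOutCyclicDefs
import Summits.Ventures.PercRepro2.SwOutCyclic

/-!
# Two instances of Theorem C: `K₄` and the wheel `W₄` (blind cell PercRepro2, night-4 g10,
2026-08-25; proofs/NIGHT4-G10.md §8)

Row (SW) on the complete graph `K₄` (= the wheel `W₃`) with the apex `l = 0` and on the wheel `W₄`
(a 4-cycle `1 2 3 4` with the hub `0`), by `sw_of_cyclic`: every vertex other than `l, h, o` is
joined to `l`.
-/

namespace Summit.Ventures.PercRepro2

namespace LocRows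

/-- `K₄` on `Fin 4`. -/
def k4 : Fin 6 → Sym2 (Fin 4)
  | 0 => s(0, 1) | 1 => s(0, 2) | 2 => s(0, 3) | 3 => s(1, 2) | 4 => s(1, 3) | 5 => s(2, 3)

/-- **Row (SW) on `K₄`** with `l = 0`, `h = 1`, `o = 2`. -/
theorem sw_k4 : Sw k4 0 1 2 := by
  refine sw_of_cyclic (l := 0) (h := 1) (o := 2) (by decide) k4 ?_
  intro x hx hxh hxo
  left
  fin_cases x
  · simp at hx
  · exact ⟨0, 0, by rw [Sym2.eq_swap]; rfl, by simp⟩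
  · exact ⟨1, 0, by rw [Sym2.eq_swap]; rfl, by simp⟩
  · exact ⟨2, 0, by rw [Sym2.eq_swap]; rfl, by simp⟩

/-- The wheel `W₄` on `Fin 5`: hub `0`, rim `1 2 3 4`. -/
def w4 : Fin 8 → Sym2 (Fin 5)
  | 0 => s(0, 1) | 1 => s(0, 2) | 2 => s(0, 3) | 3 => s(0, 4)
  | 4 => s(1, 2) | 5 => s(2, 3) | 6 => s(3, 4) | 7 => s(4, 1)

/-- **Row (SW) on the wheel `W₄`** with the hub `l = 0`, `h = 1`, `o = 3`. -/
theorem sw_w4 : Sw w4 0 1 3 := by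
  refine sw_of_cyclic (l := 0) (h := 1) (o := 3) (by decide) w4 ?_
  intro x hx hxh hxo
  left
  fin_cases x
  · simp at hx
  · exact ⟨0, 0, by rw [Sym2.eq_swap]; rfl, by simp⟩
  · exact ⟨1, 0, by rw [Sym2.eq_swap]; rfl, by simp⟩
  · exact ⟨2, 0, by rw [Sym2.eq_swap]; rfl, by simp⟩
  · exact ⟨3, 0, by rw [Sym2.eq_swap]; rfl, by simp⟩

end LocRows

end Summit.Ventures.PercRepro2
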